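import Summits.CriticalPhenomena.PercolationContinuityZ3.Theorems.PercNearOneGluingNoHeavyLowerTailIncStarTwoSepGlue
import Summits.CriticalPhenomena.PercolationContinuityZ3.Theorems.PercNearOneGluingNoHeavyLowerTailIncStarLocalBlocks
import Summits.CriticalPhenomena.PercolationContinuityZ3.Theorems.PercNearOneGluingNoHeavyLowerTailFrontierDecRowsHubStrippingRows
import HarnessLib

/-!
# The two-separation gluing theorem for the increasing star, VI: the increasing star is a property of the blocks of the environment

Support file for the Sahi programme (`--supports stmt-CriticalPhenomena-4575`, prover prim-sahi-p2 gen 23).  No definitions, no named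
facts, no sorries; standard axioms.  Memo `run/shared/lean/prim/prim-sahi/FROM-prim-sahi-p2-gen22-TWO-SEPARATION-GLUING.md` §3
(COROLLARIES B and C), `prim-sahi-p2/PROOF-E3.md` §32–§33.

Setting: root `s`, a vertex `x ≠ s`, `V ∖ {s, x} = L ⊔ R` with no positive pair between `L` and `R` — `x` is a CUT VERTEX OF THE
ENVIRONMENT `H = G − s` (the positive pairs avoiding the root), the root pairs being arbitrary; the two blocks (with the root) are
`insert s (insert x L)` and `Lᶜ`.  The hypothesis "STAR inside the block `K` for every root weight at `x`" reads
`∀ v, ∀ t₁ t₂ t₃ ∈ K, 0 ≤ E₃({s↔t₁ in K},{s↔t₂ in K},{s↔t₃ in K})` under `prodBernoulli (w[s(s,x) ↦ v])`.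
* `incStar_nonneg_of_lobe_far` (targets `0 | 3`: `a, b, c ∉ L`): STAR inside `Lᶜ` for every root weight at `x` ⟹ `0 ≤ E₃({s↔a},{s↔b},{s↔c})`
  — gen 11's blob reduction (`SahiBlobReduction.exists_blobReduce`, terminals `s, x`); the split `1 | 2` is THEOREM G itself
  (`IncStar.incStar_nonneg_of_twoSep`).
* `incStar_nonneg_of_envCutVertex` — **COROLLARY B (block property)**: STAR inside both blocks for every root weight at `x` ⟹ STAR for
  ALL targets; `incStar_openConnIn_nonneg_of_envCutVertex` — the same RELATIVE to a vertex set `K ∋ s, x` (weights outside `K` arbitrary),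
  the composable form for an induction along the block–cut tree of the environment.
* `incStar_nonneg_of_envCutVertex_apexUnicyclic` — **COROLLARY C for two blocks**: if the positive pairs inside `insert x L` avoiding `s`
  and those inside `Lᶜ` avoiding `s` are forests plus at most one pair each, STAR holds for all targets (gen 21/22's relative
  apex-unicyclic theorem `IncStar.incStar_openConnIn_nonneg_of_apexUnicyclic` supplies the block hypotheses): the environment may carry two
  independent cycles in different blocks through `x` under an arbitrary root star (e.g. the root joined to every vertex of a bowtie) —
  the first kernel instance of STAR on cactus environments beyond one cycle.
-/

noncomputable section

namespace Summit.CriticalPhenomena.PercolationContinuityZ3.Theorems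

namespace IncStar

open MeasureTheory Set Literature.Probability.Percolation Literature.Probability.LatticeModels
open Literature.Probability.Percolation.DecisionTree (ind)
open scoped Classical

variable {n : ℕ}

/-! ### Plumbing -/

/-- Changing the weight of a pair through the root does not change the environment inside `K`. [folklore] -/
theorem envIn_update_rootPair (w : Sym2 (Fin n) → unitInterval) (K : Set (Fin n)) (s x : Fin n) (v : unitInterval) :
    {z : Sym2 (Fin n) | s ∉ z ∧ (∀ y ∈ z, y ∈ K) ∧ Function.update w s(s, x) v z ≠ 0}
      = {z : Sym2 (Fin n) | s ∉ z ∧ (∀ y ∈ z, y ∈ K) ∧ w z ≠ 0} := by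
  ext z
  simp only [Set.mem_setOf_eq]
  have key : s ∉ z → Function.update w s(s, x) v z = w z := fun hs =>
    Function.update_of_ne (show z ≠ s(s, x) by rintro rfl; exact hs (Sym2.mem_mk_left s x)) _ _
  constructor
  · rintro ⟨hs, hK, hw⟩; exact ⟨hs, hK, by rwa [key hs] at hw⟩
  · rintro ⟨hs, hK, hw⟩; exact ⟨hs, hK, by rwa [key hs]⟩

/-- `{x ↔ t in S}` is empty when `t ∉ S`. [folklore] -/
theorem openConnIn_eq_empty_of_not_mem {S : Set (Fin n)} {x t : Fin n} (ht : t ∉ S) :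
    (openConnIn S x t : Set (BondConfig (Fin n))) = ∅ :=
  Set.subset_empty_iff.1 fun _ ⟨_, hy, _⟩ => ht hy

/-! ### The lobe (targets `0 | 3`) -/

/-- **Targets `0 | 3` across an environment cut vertex (lobe).**  `x ≠ s`, `s, x ∉ L`, no positive pair between `L` and
`V ∖ (L ∪ {s,x})`, `a, b, c ∉ L`.  If the increasing star holds inside `Lᶜ` for `a, b, c` under `w[s(s,x) ↦ v]` for every `v`, then
`0 ≤ E₃({s↔a},{s↔b},{s↔c})`. (Gen 11's blob reduction at the terminals `s, x`: the near side only changes the root weight at `x`.)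
[this work] -/
theorem incStar_nonneg_of_lobe_far (w : Sym2 (Fin n) → unitInterval) (L : Set (Fin n)) {s x a b c : Fin n}
    (hxs : x ≠ s) (hsL : s ∉ L) (hxL : x ∉ L) (haL : a ∉ L) (hbL : b ∉ L) (hcL : c ∉ L)
    (hcross : ∀ y z : Fin n, y ∈ L → z ∉ L → z ≠ s → z ≠ x → w s(y, z) = 0)
    (hR : ∀ v : unitInterval,
      0 ≤ sahiE3 (prodBernoulli (Function.update w s(s, x) v)) (openConnIn Lᶜ s a) (openConnIn Lᶜ s b) (openConnIn Lᶜ s c)) :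
    0 ≤ sahiE3 (prodBernoulli w) (openConn s a) (openConn s b) (openConn s c) := by
  set Lf : Finset (Fin n) := (Set.toFinite L).toFinset with hLf
  have memLf : ∀ {y : Fin n}, y ∈ Lf ↔ y ∈ L := fun {y} => Set.Finite.mem_toFinset _
  obtain ⟨w', hw'B, hw'off, -, hE⟩ := SahiBlobReduction.exists_blobReduce w Lf (u := s) (v := x)
    (fun h => hsL (memLf.1 h)) (fun h => hxL (memLf.1 h)) hxs.symm
    (fun y hy z hz hzs hzx => hcross y z (memLf.1 hy) (fun h => hz (memLf.2 h)) hzs hzx)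
  rw [IncStarIrreducible.sahiE3_openConn_eq_of_sahiE_eq w w' (fun T hT => hE s (fun h => hsL (memLf.1 h)) 3 T fun i t ht => ?_)]
  swap
  · rcases hT i t ht with rfl | rfl | rfl
    exacts [fun h => haL (memLf.1 h), fun h => hbL (memLf.1 h), fun h => hcL (memLf.1 h)]
  have hexit : ∀ p ∈ Lᶜ, ∀ q ∉ Lᶜ, w' s(p, q) = 0 := by
    intro p _ q hq
    have hqL : q ∈ L := by rwa [Set.mem_compl_iff, not_not] at hq
    rw [Sym2.eq_swap]; exact hw'B q (memLf.2 hqL) p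
  rw [IncStarIrreducible.sahiE3_openConn_eq_openConnIn_of_no_exit w' Lᶜ hexit (show s ∈ Lᶜ from hsL) a b c]
  have hagree : ∀ e : Sym2 (Fin n), ¬ e.IsDiag → (∀ z ∈ e, z ∈ Lᶜ) → w' e = Function.update w s(s, x) (w' s(s, x)) e := by
    intro e _ he
    by_cases hesx : e = s(s, x)
    · rw [hesx, Function.update_self]
    · rw [Function.update_of_ne hesx]
      exact hw'off e (fun y hy hye => (he y hye) (memLf.1 hy)) hesx
  rw [IncStarIrreducible.sahiE3_openConnIn_congr_weight w' _ Lᶜ hagree s a b c]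
  exact hR _

/-! ### COROLLARY B: the block property -/

/-- **COROLLARY B — the increasing star is a property of the blocks of the environment.**  Let `x ≠ s`, `s, x ∉ L`, and let no
positive pair join `L` to `V ∖ (L ∪ {s, x})` (so `x` is a cut vertex of the environment `G − s` with blocks on `insert x L` and on
`Lᶜ ∖ {s}`; the root pairs are arbitrary).  If the increasing star holds inside `insert s (insert x L)` and inside `Lᶜ`, for all targets
there, under `w[s(s,x) ↦ v]` for every `v`, then `0 ≤ E₃({s↔a},{s↔b},{s↔c})` for ALL targets. (THEOREM G for the splits `1|2`, `2|1`;
the lobe reduction for `0|3`, `3|0`.) [this work] -/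
theorem incStar_nonneg_of_envCutVertex (w : Sym2 (Fin n) → unitInterval) (L : Set (Fin n)) {s x : Fin n}
    (hxs : x ≠ s) (hsL : s ∉ L) (hxL : x ∉ L)
    (hcross : ∀ y z : Fin n, y ∈ L → z ∉ L → z ≠ s → z ≠ x → w s(y, z) = 0)
    (hLblock : ∀ (v : unitInterval) (t₁ t₂ t₃ : Fin n), t₁ ∈ (insert s (insert x L) : Set (Fin n)) →
      t₂ ∈ (insert s (insert x L) : Set (Fin n)) → t₃ ∈ (insert s (insert x L) : Set (Fin n)) →
        0 ≤ sahiE3 (prodBernoulli (Function.update w s(s, x) v)) (openConnIn (insert s (insert x L)) s t₁)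
          (openConnIn (insert s (insert x L)) s t₂) (openConnIn (insert s (insert x L)) s t₃))
    (hRblock : ∀ (v : unitInterval) (t₁ t₂ t₃ : Fin n), t₁ ∈ Lᶜ → t₂ ∈ Lᶜ → t₃ ∈ Lᶜ →
        0 ≤ sahiE3 (prodBernoulli (Function.update w s(s, x) v)) (openConnIn Lᶜ s t₁) (openConnIn Lᶜ s t₂) (openConnIn Lᶜ s t₃))
    (a b c : Fin n) :
    0 ≤ sahiE3 (prodBernoulli w) (openConn s a) (openConn s b) (openConn s c) := by
  -- coincident marks
  by_cases hdist : s ≠ a ∧ s ≠ b ∧ s ≠ c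
  swap
  · push Not at hdist
    refine IncStarIrreducible.incStar_of_not_distinct w ?_
    tauto
  obtain ⟨hsa, hsb, hsc⟩ := hdist
  -- the other side `R = V ∖ (L ∪ {s, x})` and the separation seen from it
  set R : Set (Fin n) := {y | y ∉ L ∧ y ≠ s ∧ y ≠ x} with hR
  have hsR : s ∉ R := fun h => h.2.1 rfl
  have hxR : x ∉ R := fun h => h.2.2 rfl
  have hcrossR : ∀ y z : Fin n, y ∈ R → z ∉ R → z ≠ s → z ≠ x → w s(y, z) = 0 := by
    intro y z hy hz hzs hzx
    have hzL : z ∈ L := by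
      by_contra h; exact hz ⟨h, hzs, hzx⟩
    rw [Sym2.eq_swap]; exact hcross z y hzL hy.1 hy.2.1 hy.2.2
  -- `Rᶜ` is the block `insert s (insert x L)`
  have hRc : Rᶜ = (insert s (insert x L) : Set (Fin n)) := by
    ext y
    simp only [Set.mem_compl_iff, hR, Set.mem_setOf_eq, Set.mem_insert_iff, not_and, not_not]
    constructor
    · intro h
      by_cases hyL : y ∈ L
      · exact Or.inr (Or.inr hyL)
      · by_cases hys : y = s
        · exact Or.inl hys
        · exact Or.inr (Or.inl (h hyL hys))
    · rintro (h | h | h)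
      · exact fun _ hys => absurd h hys
      · exact fun _ _ => h
      · exact fun hyL => absurd h hyL
  have hRblock' : ∀ (v : unitInterval) (t₁ t₂ t₃ : Fin n), t₁ ∈ Rᶜ → t₂ ∈ Rᶜ → t₃ ∈ Rᶜ →
      0 ≤ sahiE3 (prodBernoulli (Function.update w s(s, x) v)) (openConnIn Rᶜ s t₁) (openConnIn Rᶜ s t₂) (openConnIn Rᶜ s t₃) := by
    rw [hRc]; exact hLblock
  -- membership bookkeeping
  have toR : ∀ {t : Fin n}, t ∉ L → s ≠ t → t ≠ x → t ∈ R := fun ht hst htx => ⟨ht, fun h => hst h.symm, htx⟩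
  have offR : ∀ {t : Fin n}, t ∈ L → t ∉ R := fun ht h => h.1 ht
  -- the block hypotheses in the shape consumed by the two reductions
  have farL : ∀ {t u v : Fin n}, t ∈ L → u ∉ L → s ≠ u → v ∉ L → s ≠ v →
      0 ≤ sahiE3 (prodBernoulli w) (openConn s t) (openConn s u) (openConn s v) :=
    fun ht hu hsu hv hsv => incStar_nonneg_of_twoSep w L hxs hsL hxL ht hu (Ne.symm hsu) hv (Ne.symm hsv) hcross
      fun v _ => hRblock v _ _ _ hxL hu hv
  have farR : ∀ {t u v : Fin n}, t ∈ R → u ∉ R → s ≠ u → v ∉ R → s ≠ v →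
      0 ≤ sahiE3 (prodBernoulli w) (openConn s t) (openConn s u) (openConn s v) :=
    fun ht hu hsu hv hsv => incStar_nonneg_of_twoSep w R hxs hsR hxR ht hu (Ne.symm hsu) hv (Ne.symm hsv) hcrossR
      fun v _ => hRblock' v _ _ _ hxR hu hv
  have lobeL : ∀ {t u v : Fin n}, t ∉ L → u ∉ L → v ∉ L →
      0 ≤ sahiE3 (prodBernoulli w) (openConn s t) (openConn s u) (openConn s v) :=
    fun ht hu hv => incStar_nonneg_of_lobe_far w L hxs hsL hxL ht hu hv hcross fun v => hRblock v _ _ _ ht hu hv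
  have lobeR : ∀ {t u v : Fin n}, t ∉ R → u ∉ R → v ∉ R →
      0 ≤ sahiE3 (prodBernoulli w) (openConn s t) (openConn s u) (openConn s v) :=
    fun ht hu hv => incStar_nonneg_of_lobe_far w R hxs hsR hxR ht hu hv hcrossR fun v => hRblock' v _ _ _ ht hu hv
  -- eight placements of the targets
  by_cases haL : a ∈ L
  · by_cases hbL : b ∈ L
    · by_cases hcL : c ∈ L
      · exact lobeR (offR haL) (offR hbL) (offR hcL)
      · by_cases hcx : c = x
        · subst hcx; exact lobeR (offR haL) (offR hbL) hxR
        · rw [sahiE3_comm₂₃, sahiE3_comm₁₂]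
          exact farR (toR hcL hsc hcx) (offR haL) hsa (offR hbL) hsb
    · by_cases hcL : c ∈ L
      · by_cases hbx : b = x
        · subst hbx; exact lobeR (offR haL) hxR (offR hcL)
        · rw [sahiE3_comm₁₂]
          exact farR (toR hbL hsb hbx) (offR haL) hsa (offR hcL) hsc
      · exact farL haL hbL hsb hcL hsc
  · by_cases hbL : b ∈ L
    · by_cases hcL : c ∈ L
      · by_cases hax : a = x
        · subst hax; exact lobeR hxR (offR hbL) (offR hcL)
        · exact farR (toR haL hsa hax) (offR hbL) hsb (offR hcL) hsc
      · rw [sahiE3_comm₁₂]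
        exact farL hbL haL hsa hcL hsc
    · by_cases hcL : c ∈ L
      · rw [sahiE3_comm₂₃, sahiE3_comm₁₂]
        exact farL hcL haL hsa hbL hsb
      · exact lobeL haL hbL hcL

/-! ### COROLLARY B relative to a vertex set -/

/-- **The block property inside a vertex set** (composable form).  Let `s, x ∈ K`, `L ⊆ K ∖ {s, x}`, and let no positive pair join
`L` to `K ∖ (L ∪ {s, x})`.  If the increasing star holds inside `insert s (insert x L)` and inside `K ∖ L`, for all targets there, under
`w[s(s,x) ↦ v]` for every `v`, then `0 ≤ E₃({s↔a in K},{s↔b in K},{s↔c in K})` for all `a, b, c ∈ K` — whatever the weights outside `K`.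
Iterate along the block–cut tree of the environment inside `K`. [this work] -/
theorem incStar_openConnIn_nonneg_of_envCutVertex (w : Sym2 (Fin n) → unitInterval) {K L : Set (Fin n)} {s x : Fin n}
    (hxs : x ≠ s) (hsK : s ∈ K) (hxK : x ∈ K) (hLK : L ⊆ K) (hsL : s ∉ L) (hxL : x ∉ L)
    (hcross : ∀ y z : Fin n, y ∈ L → z ∈ K → z ∉ L → z ≠ s → z ≠ x → w s(y, z) = 0)
    (hLblock : ∀ (v : unitInterval) (t₁ t₂ t₃ : Fin n), t₁ ∈ (insert s (insert x L) : Set (Fin n)) →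
      t₂ ∈ (insert s (insert x L) : Set (Fin n)) → t₃ ∈ (insert s (insert x L) : Set (Fin n)) →
        0 ≤ sahiE3 (prodBernoulli (Function.update w s(s, x) v)) (openConnIn (insert s (insert x L)) s t₁)
          (openConnIn (insert s (insert x L)) s t₂) (openConnIn (insert s (insert x L)) s t₃))
    (hRblock : ∀ (v : unitInterval) (t₁ t₂ t₃ : Fin n), t₁ ∈ K \ L → t₂ ∈ K \ L → t₃ ∈ K \ L →
        0 ≤ sahiE3 (prodBernoulli (Function.update w s(s, x) v)) (openConnIn (K \ L) s t₁) (openConnIn (K \ L) s t₂)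
          (openConnIn (K \ L) s t₃))
    {a b c : Fin n} (ha : a ∈ K) (hb : b ∈ K) (hc : c ∈ K) :
    0 ≤ sahiE3 (prodBernoulli w) (openConnIn K s a) (openConnIn K s b) (openConnIn K s c) := by
  have hm : ∀ X : Set (BondConfig (Fin n)), MeasurableSet X := fun _ => MeasurableSet.of_discrete
  -- the determining set of pairs (all pairs inside `K`) and the restricted weight
  set D : Set (Sym2 (Fin n)) := {z : Sym2 (Fin n) | ∀ y ∈ z, y ∈ K} with hD
  set wK : Sym2 (Fin n) → unitInterval := fun z => @ite _ (z ∈ D) (Classical.propDecidable _) (w z) 0 with hwK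
  have hwKz : ∀ z, wK z = @ite _ (z ∈ D) (Classical.propDecidable _) (w z) 0 := fun z => rfl
  have wK_in : ∀ z : Sym2 (Fin n), (∀ y ∈ z, y ∈ K) → wK z = w z := fun z hz => by
    rw [hwKz, if_pos (show z ∈ D from hz)]
  have wK_out : ∀ y t : Fin n, t ∉ K → wK s(y, t) = 0 := fun y t ht => by
    rw [hwKz, if_neg (show s(y, t) ∉ D from fun h => ht (h t (Sym2.mem_mk_right y t)))]
  have hdet : ∀ p q : Fin n, DeterminedBy (openConnIn K p q : Set (BondConfig (Fin n))) D :=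
    fun p q => (IncStarCutVertex.determinedBy_openConnIn_offDiag K p q).mono fun z hz => hz.2
  -- (1) restrict the weight to `K`
  rw [← sahiE3_restrict_eq_of_determinedBy w (hdet s a) (hdet s b) (hdet s c)]
  show 0 ≤ sahiE3 (prodBernoulli wK) (openConnIn K s a) (openConnIn K s b) (openConnIn K s c)
  -- (2) under `wK` the `K`-local events are a.s. the plain root connections
  set L' : Set (Fin n) := K \ {s} with hL'
  have hKL : insert s L' = K := insert_diff_singleton_of_mem hsK
  have hsL' : s ∉ L' := fun h => h.2 rfl
  set G : Set (BondConfig (Fin n)) := {ω | ∀ e, wK e = 0 → e ∉ ω}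
  have hG1 : (prodBernoulli wK).real G = 1 := real_sureClosed wK
  have hωG : ∀ ω ∈ G, ∀ p q : Fin n, p ∈ L' → q ∉ L' → q ≠ s → s(p, q) ∉ ω :=
    fun ω hω p q _ hq hqs => hω _ (wK_out p q (not_mem_of_not_mem_diff_singleton hq hqs))
  have hev : ∀ t : Fin n, t ∈ K → ∀ ω ∈ G, (ω ∈ openConnIn K s t ↔ ω ∈ openConn s t) := by
    intro t ht ω hω
    have h := bridge_conn_ll L' hsL' (hωG ω hω) (Set.mem_insert s L') (show t ∈ insert s L' by rw [hKL]; exact ht)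
    rw [hKL] at h
    exact h.symm
  rw [sahiE3_congr_of_sure (hm G) hG1 (hev a ha) (hev b hb) (hev c hc)]
  -- (3) COROLLARY B for the restricted weight
  have hcrossK : ∀ y z : Fin n, y ∈ L → z ∉ L → z ≠ s → z ≠ x → wK s(y, z) = 0 := by
    intro y z hy hz hzs hzx
    by_cases hzK : z ∈ K
    · rw [wK_in _ fun t ht => by rcases Sym2.mem_iff.1 ht with rfl | rfl; exacts [hLK hy, hzK]]
      exact hcross y z hy hzK hz hzs hzx
    · exact wK_out y z hzK
  have hB : ∀ y, y ∈ (insert s (insert x L) : Set (Fin n)) → y ∈ K := by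
    intro y hy
    rcases Set.mem_insert_iff.1 hy with rfl | hy
    · exact hsK
    rcases Set.mem_insert_iff.1 hy with rfl | hy
    · exact hxK
    · exact hLK hy
  have agree : ∀ (v : unitInterval) (S : Set (Fin n)), (∀ y ∈ S, y ∈ K) → ∀ e : Sym2 (Fin n), ¬ e.IsDiag → (∀ z ∈ e, z ∈ S) →
      Function.update wK s(s, x) v e = Function.update w s(s, x) v e := by
    intro v S hS e _ he
    by_cases hesx : e = s(s, x)
    · rw [hesx, Function.update_self, Function.update_self]
    · rw [Function.update_of_ne hesx, Function.update_of_ne hesx, wK_in e fun y hy => hS y (he y hy)]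
  refine incStar_nonneg_of_envCutVertex wK L hxs hsL hxL hcrossK (fun v t₁ t₂ t₃ h₁ h₂ h₃ => ?_)
    (fun v t₁ t₂ t₃ h₁ h₂ h₃ => ?_) a b c
  · rw [IncStarIrreducible.sahiE3_openConnIn_congr_weight _ _ _ (agree v _ hB) s t₁ t₂ t₃]
    exact hLblock v t₁ t₂ t₃ h₁ h₂ h₃
  · -- under `wK[s(s,x) ↦ v]` nothing leaves `K`: the `Lᶜ`-events are the `(K ∖ L)`-events
    set u := Function.update wK s(s, x) v with hu
    have hu_out : ∀ p q : Fin n, q ∉ K → u s(p, q) = 0 := by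
      intro p q hq
      have hne : s(p, q) ≠ s(s, x) := by
        rw [Ne, Sym2.eq_iff]; rintro (⟨-, h⟩ | ⟨-, h⟩); exacts [hq (h ▸ hxK), hq (h ▸ hsK)]
      rw [hu, Function.update_of_ne hne]; exact wK_out p q hq
    set G' : Set (BondConfig (Fin n)) := {ω | ∀ e, u e = 0 → e ∉ ω}
    have hG'1 : (prodBernoulli u).real G' = 1 := real_sureClosed u
    have hKL' : Lᶜ ∩ K = K \ L := by ext y; simp only [Set.mem_inter_iff, Set.mem_compl_iff, Set.mem_sdiff]; tauto
    have hev' : ∀ t : Fin n, ∀ ω ∈ G', (ω ∈ openConnIn Lᶜ s t ↔ ω ∈ openConnIn (K \ L) s t) := by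
      intro t ω hω
      have hN : ∀ p ∈ K, ∀ q ∉ K, s(p, q) ∉ ω := fun p _ q hq => hω _ (hu_out p q hq)
      constructor
      · intro h
        obtain ⟨p, hp⟩ := BlockExploration.exists_openWalk_of_mem_openConnIn h
        have hpK := SahiBlobReduction.support_subset_of_no_exit hN p hsK
        rw [← hKL']
        exact mem_openConnIn_of_openWalk p fun z hz => ⟨hp z hz, hpK z hz⟩
      · exact fun h => openConnIn_mono (by rw [← hKL']; exact Set.inter_subset_left) _ _ h
    rw [sahiE3_congr_of_sure (hm G') hG'1 (hev' t₁) (hev' t₂) (hev' t₃)]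
    -- a target outside `K` gives an empty event
    by_cases hK₁ : t₁ ∈ K
    swap
    · rw [openConnIn_eq_empty_of_not_mem (fun h => hK₁ h.1), HubStripping.sahiE3_empty₁]
    by_cases hK₂ : t₂ ∈ K
    swap
    · rw [openConnIn_eq_empty_of_not_mem (S := K \ L) (x := s) (t := t₂) (fun h => hK₂ h.1), HubStripping.sahiE3_empty₂]
    by_cases hK₃ : t₃ ∈ K
    swap
    · rw [openConnIn_eq_empty_of_not_mem (S := K \ L) (x := s) (t := t₃) (fun h => hK₃ h.1), HubStripping.sahiE3_empty₃]
    rw [IncStarIrreducible.sahiE3_openConnIn_congr_weight _ _ _ (agree v (K \ L) fun y hy => hy.1) s t₁ t₂ t₃]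
    exact hRblock v t₁ t₂ t₃ ⟨hK₁, h₁⟩ ⟨hK₂, h₂⟩ ⟨hK₃, h₃⟩

/-! ### COROLLARY C for two blocks -/

/-- **COROLLARY C for two blocks — an environment cut vertex with apex-unicyclic parts.**  Let `x ≠ s`, `s, x ∉ L`, and let no
positive pair join `L` to `V ∖ (L ∪ {s, x})`.  If the positive pairs inside `insert x L` avoiding `s` form a forest after deleting one
pair `z₁`, and the positive pairs inside `Lᶜ` avoiding `s` form a forest after deleting one pair `z₂`, then
`0 ≤ E₃({s↔a},{s↔b},{s↔c})` for ALL targets — although the environment may carry two independent cycles under an arbitrary root star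
(memo §3). [this work] -/
theorem incStar_nonneg_of_envCutVertex_apexUnicyclic (w : Sym2 (Fin n) → unitInterval) (L : Set (Fin n)) {s x : Fin n}
    (hxs : x ≠ s) (hsL : s ∉ L) (hxL : x ∉ L)
    (hcross : ∀ y z : Fin n, y ∈ L → z ∉ L → z ≠ s → z ≠ x → w s(y, z) = 0)
    (z₁ : Sym2 (Fin n))
    (h₁ : ((SimpleGraph.fromEdgeSet
      {z : Sym2 (Fin n) | s ∉ z ∧ (∀ y ∈ z, y ∈ (insert x L : Set (Fin n))) ∧ w z ≠ 0}).deleteEdges {z₁}).IsAcyclic)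
    (z₂ : Sym2 (Fin n))
    (h₂ : ((SimpleGraph.fromEdgeSet {z : Sym2 (Fin n) | s ∉ z ∧ (∀ y ∈ z, y ∈ Lᶜ) ∧ w z ≠ 0}).deleteEdges {z₂}).IsAcyclic)
    (a b c : Fin n) :
    0 ≤ sahiE3 (prodBernoulli w) (openConn s a) (openConn s b) (openConn s c) := by
  have hsK : s ∈ (insert s (insert x L) : Set (Fin n)) := Set.mem_insert s _
  -- the environment inside `insert s (insert x L)` is the environment inside `insert x L` (pairs through `s` are excluded)
  have henv : ∀ v : unitInterval,
      {z : Sym2 (Fin n) | s ∉ z ∧ (∀ y ∈ z, y ∈ (insert s (insert x L) : Set (Fin n))) ∧ Function.update w s(s, x) v z ≠ 0}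
        = {z : Sym2 (Fin n) | s ∉ z ∧ (∀ y ∈ z, y ∈ (insert x L : Set (Fin n))) ∧ w z ≠ 0} := by
    intro v
    rw [envIn_update_rootPair]
    ext z
    simp only [Set.mem_setOf_eq]
    constructor
    · rintro ⟨hs, hK, hw⟩
      refine ⟨hs, fun y hy => ?_, hw⟩
      rcases Set.mem_insert_iff.1 (hK y hy) with h | h
      · exact absurd hy (h ▸ hs)
      · exact h
    · rintro ⟨hs, hK, hw⟩
      exact ⟨hs, fun y hy => Set.mem_insert_of_mem s (hK y hy), hw⟩
  refine incStar_nonneg_of_envCutVertex w L hxs hsL hxL hcross (fun v t₁ t₂ t₃ ht₁ ht₂ ht₃ => ?_)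
    (fun v t₁ t₂ t₃ ht₁ ht₂ ht₃ => ?_) a b c
  · refine incStar_openConnIn_nonneg_of_apexUnicyclic _ hsK ht₁ ht₂ ht₃ z₁ ?_
    rw [henv v]; exact h₁
  · refine incStar_openConnIn_nonneg_of_apexUnicyclic _ (K := Lᶜ) hsL ht₁ ht₂ ht₃ z₂ ?_
    rw [envIn_update_rootPair]; exact h₂

end IncStar

end Summit.CriticalPhenomena.PercolationContinuityZ3.Theorems
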